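import Literature.MathematicalPhysics.QuantumFieldTheory.Balaban1983to89.B13NeumannChains

/-!
# `Balaban1983to89.B13JointWalkExpansionNeumann` — T. Bałaban, *Propagators for lattice gauge theories in a background
field*, Commun. Math. Phys. **99** (1985) 389–434 [Balaban1985BackgroundPropagators] («[13]» of [Balaban1988RG2Cluster]),
(3.106) p. 414 *"For M sufficiently large this implies G = G₀(I − R)⁻¹ = Σ_{n=0}^∞ G₀Rⁿ"*, (3.130) p. 421, p. 422 *"Of
course Theorem 3.10 holds also because we replace each operator in (3.130) by its random walk expansion … each operator
Δ′_π provides the small factor"*, Thm 3.12 p. 423, with [Balaban1988RG2Cluster] p. 13 *"The resolvent (xI + C*Δ_kC)⁻¹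
has a representation similar to (C*Δ_kC)⁻¹"*: THE NEUMANN ∕ INVERSE CLOSURE OF THE JOINT-WALK-EXPANSION SHAPE — a
walk-expanded SMALL step family `K(σ,u)` and a walk-expanded seed family `C(σ,u)` give a joint walk expansion
(`B13JointWalkExpansion.JointWalkExpansion`, all eight fields) of `(1 − K)⁻¹·C`, of `(1 − K)⁻¹`, and of `C·(1 − K)⁻¹`,
whose terms are the CHAINS of step terms over a seed term, with letters independent of the torus

statement-level bookkeeping over published theorems with citation tags; kernel-checked compositions of tree theorems;
nothing here is a claim about the Yang–Mills mass gap.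

PROVENANCE ∕ WHY (cell `pub-ymgap`, D-0062 Track A, node N10 = [B13]; seat `pub-ymgap-dag-n10-c` g4, module 26b;
FAN-OUT v1.1 §N10 s1 ≡ §N06 s4 «NODE A's object content: `JointWalkExpansion`s for `G_k(U)`-built kernels»).  The tree's
Literature walk calculus had the shape (`B13JointWalkExpansion`), the one-step base cases (`B13LocalKernelWalks`,
`B13DomainKernelWalks(Decay)`) and the closure under re-indexing ∕ transposition ∕ scalars ∕ sums ∕ products
(`B13JointWalkExpansionAlgebra`, type-B13 p453855), but NOT the Neumann ∕ inverse step of [13] (3.106) ∕ (3.130) — which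
is how `G_k(U)` is BUILT from one-step factors («parametrix × (I − R)⁻¹»).  The Summit-side twin is
`Gaps.D4WalkNeumann.jointWalkExpansion_inv(_pencil)` (cell `pub-balaban-gaps`, seat g1-p2 gen 4, over ne5's T9), stated
for the pencil `(A + tP)⁻¹` and not importable from Literature.  THIS FILE is its Literature home in the GENERAL form «any
walk-expanded small step family, any walk-expanded seed», over module 26a (`B13NeumannChains`: chain bounds, uniform
partial sums by `B9SectDWalk.neumann_majSumLe`, level sums, resolvent identity); invertibility of `1 − K` is DERIVED (the
identity seed), not assumed.

WHAT THIS FILE PROVES (all `theorem`s; geometry `toB6 (torusGeom Nf 0 0 0) 0 True` = the one-scale ℓ¹ site torus).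
§1 Chains of matrix families: `differentiableOn_chain` (termwise analyticity by list induction), `chain_congr`
   (σ-independence), `transpose_chain` (the transposed chain of transposes is the seed followed by the steps read from
   the end: `(S_{i₁}ᵀ⋯S_{iₙ}ᵀT₀ᵀ)ᵀ = T₀S_{iₙ}⋯S_{i₁}`).
§2 `jointWalkExpansion_one` — the identity family is its own one-term expansion (`W = Unit`, `SX = ∅`, `A = 1`, `D = d₁`,
   `K̄ = 1`, any `0 ≤ ε ≤ ρ`, `κ ≤ ρ − ε`).
§3 ★ `jointWalkExpansion_neumann` — DATA: a joint walk expansion of the STEP family `K` (square, package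
   `(ρ_K, ε_K, κ_K, K̄_K)`) and of the SEED family `C` (`(ρ_C, ε_C, κ_C, K̄_C)`), same σ-region and ball, walk
   distances dominating `d₁`, fibre `m`, row sums `(σ₁,c₁)` (junction) and `(σ′,c′)` (summation); RATES: chain rate
   `ρ` and window `0 ≤ ε ≤ ρ` with `ρ + σ₁ ≤ ρ_K` (every step pays its own junction from its excess rate), `ρ ≤ ρ_C`,
   both factor windows containing the chain window (`ρ_K − ε_K ≤ ρ − ε`, `ρ_C − ε_C ≤ ρ − ε`), torus rate `0 ≤ κ ≤ κ_C`,
   `κ + σ′ ≤ κ_K`; the SMALLNESS `q = (mc₁)·K̄_K·c′ < 1` (*"each operator Δ′_π provides the small factor"*).  CONCLUSION: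
   `(σ,u) ↦ (1 − K(σ,u))⁻¹·C(σ,u)` is a `JointWalkExpansion` with terms the chains `T_K(i₁)⋯T_K(iₙ)·T_C(ω)` on
   `List W_K × W_C`, σ-carrying sub-family «the seed or some step carries σ», amplitudes `chainConst m c₁ A_K (A_C ω)`,
   distances `chainDist D_K (D_C ω)`, rate `ρ`, window `ε`, torus rate `κ`, constant `K̄_C(1 − q)⁻¹` — every letter
   independent of the torus; `one_sub_mul_inv_of_jointWalkExpansion` (invertibility of `1 − K` from the walk data alone);
   `domBy_chain`.
§4 ★ `jointWalkExpansion_resolvent` (`(1 − K)⁻¹`, the identity seed: constant `(1 − q)⁻¹`), ★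
   `jointWalkExpansion_neumann_right` (`C·(1 − K)⁻¹ = Σ C Kⁿ` — (3.106)'s `G₀(I − R)⁻¹` literally: terms
   `T_C(ω)·T_K(iₙ)⋯T_K(i₁)`, by two transpositions), `domBy_chain_right`.
HONEST FRAMING: kernel-level bookkeeping (finite matrices on finite tori, absolutely convergent series of entries) over
the tree's hypothesis SHAPE; the step ∕ seed families and all letters are HYPOTHESES; NOTHING of Bałaban's `G_k(Ω)`,
`Δ_k`, `C^{(k)}`, `R_α(X)` is constructed or asserted — whether HIS one-step factors carry such expansions k-uniformly at
complex backgrounds with the printed smallness `O(M⁻¹)` ([13] (3.89), p. 414; cell GAPS G-B9-05∕06a∕07; node N06) stays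
the INPUT; (D4) ∕ NODE A NOT discharged; count-neutral; NOT a discharge of N10; no `sorry`, no `def`, no new named fact;
standard axioms; nothing continuum ∕ ℝ⁴ ∕ OS ∕ mass gap ∕ Clay.
-/

noncomputable section

namespace Literature.MathematicalPhysics.QuantumFieldTheory.Balaban1983to89.B13JointWalkExpansionNeumann

open Metric Set Finset
open scoped Matrix
open Literature.MathematicalPhysics.QuantumFieldTheory.Balaban1983to89
open Literature.MathematicalPhysics.QuantumFieldTheory.Balaban1983to89.B9SectDWalk
  (Through MajSumLe DomBy infConv chainConst chainDist domBy_chainDist through_chainDist_seed through_chainDist_mem)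
open Literature.MathematicalPhysics.QuantumFieldTheory.Balaban1983to89.B9Thm34Ext (toB6)
open Literature.MathematicalPhysics.QuantumFieldTheory.Balaban1983to89.B9Thm37GlueTorus
  (torusGeom tdist1 tdist1_nonneg tdist1_comm tdist1_self hdnn_torusGeom htri_torusGeom)
open Literature.MathematicalPhysics.QuantumFieldTheory.Balaban1983to89.TreeLengthTorus (TPt)
open Literature.MathematicalPhysics.QuantumFieldTheory.Balaban1983to89.B5TorusCover (UT)
open Literature.MathematicalPhysics.QuantumFieldTheory.Balaban1983to89.B11SectG (RowSum)
open Literature.MathematicalPhysics.QuantumFieldTheory.Balaban1983to89.B13JointWalkExpansion (JointWalkExpansion)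
open Literature.MathematicalPhysics.QuantumFieldTheory.Balaban1983to89.B13JointWalkExpansionAlgebra
  (jointWalkExpansion_transpose)
open Literature.MathematicalPhysics.QuantumFieldTheory.Balaban1983to89.B13NeumannChains
  (chainDist_nonneg norm_chain_entry_le majSumLe_chain hasSum_levels one_sub_mul_tsum_eq)

variable {ν : ℕ} {Nf : Fin ν → ℕ} [∀ i, NeZero (Nf i)]
variable {d N' : ℕ} {n q : Type} [Fintype n] [DecidableEq n]
variable {E : Type*} [NormedAddCommGroup E] [NormedSpace ℂ E]

/-! ## §1. Chains of matrix families: termwise analyticity, σ-independence, transposition -/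

section Chains

variable {ι : Type}

omit [DecidableEq n] in
/-- Entries of a product of two entrywise-differentiable matrix families are differentiable (finite sum of products).
[cite: Balaban1988RG2Cluster, p.15] -/
private theorem differentiableOn_mul_entry {p r : Type} [Fintype r] {M₁ : E → Matrix p r ℂ} {M₂ : E → Matrix r q ℂ}
    {s : Set E} (h₁ : ∀ a k, DifferentiableOn ℂ (fun u => M₁ u a k) s) (h₂ : ∀ k b, DifferentiableOn ℂ (fun u => M₂ u k b) s)
    (a : p) (b : q) : DifferentiableOn ℂ (fun u => (M₁ u * M₂ u) a b) s := by
  have e : (fun u => (M₁ u * M₂ u) a b) = fun u => ∑ k, M₁ u a k * M₂ u k b := funext fun u => Matrix.mul_apply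
  rw [e]
  exact DifferentiableOn.fun_sum fun k _ => (h₁ a k).mul (h₂ k b)

omit [DecidableEq n] in
/-- **Termwise analyticity of the chains** (the `termAnalytic` field of §3 in its literal shape; Literature form of the
Summit-side `Gaps.D4WalkNeumann.differentiableOn_neumannChain`): every chain `S_{i₁}(u)⋯S_{iₙ}(u)·T₀(u)` has entries
complex-differentiable on `s` when the factors' entries are — [13] Thm 3.10: a term is a finite product of local operators;
[II] p. 15: the quadratic forms are analytic functions of `(U, J)`. [cite: Balaban1985BackgroundPropagators, Thm 3.10 p.416; Balaban1988RG2Cluster, p.15] -/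
theorem differentiableOn_chain {S : ι → E → Matrix n n ℂ} {T₀ : E → Matrix n q ℂ} {s : Set E}
    (hS : ∀ i a k, DifferentiableOn ℂ (fun u => S i u a k) s) (hT : ∀ k b, DifferentiableOn ℂ (fun u => T₀ u k b) s) :
    ∀ (l : List ι) (a : n) (b : q), DifferentiableOn ℂ (fun u => (l.foldr (fun i M => S i u * M) (T₀ u)) a b) s := by
  intro l
  induction l with
  | nil => intro a b; simpa only [List.foldr_nil] using hT a b
  | cons i l ih =>
      intro a b
      simp only [List.foldr_cons]
      exact differentiableOn_mul_entry (M₁ := fun u => S i u)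
        (M₂ := fun u => l.foldr (fun i M => S i u * M) (T₀ u)) (hS i) ih a b

omit [DecidableEq n] in
/-- Two chains with the same steps along the list and the same seed agree (σ-independence: every factor of a σ-free chain
takes its `σ = 0` value). [cite: Balaban1988RG2Cluster, p.13] -/
theorem chain_congr {S S' : ι → Matrix n n ℂ} {T T' : Matrix n q ℂ} :
    ∀ (l : List ι), (∀ i ∈ l, S i = S' i) → T = T' →
      l.foldr (fun i M => S i * M) T = l.foldr (fun i M => S' i * M) T' := by
  intro l
  induction l with
  | nil => intro _ hT; simpa using hT
  | cons i l ih =>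
      intro hS hT
      simp only [List.foldr_cons]
      rw [hS i (by simp), ih (fun j hj => hS j (by simp [hj])) hT]

omit [DecidableEq n] in
/-- **The transposed chain of transposes is the seed followed by the steps read from the end**:
`(S_{i₁}ᵀ⋯S_{iₙ}ᵀ·T₀ᵀ)ᵀ = T₀·S_{iₙ}⋯S_{i₁}` — how (3.106)'s `G₀Rⁿ` (seed on the LEFT) is read off the left-chain form.
[cite: Balaban1985BackgroundPropagators, (3.106) p.414, (3.107) p.416] -/
theorem transpose_chain {S : ι → Matrix n n ℂ} {T₀ : Matrix q n ℂ} :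
    ∀ l : List ι, (l.foldr (fun i M => (S i)ᵀ * M) T₀ᵀ)ᵀ = l.foldr (fun i M => M * S i) T₀ := by
  intro l
  induction l with
  | nil => simp
  | cons i l ih => simp only [List.foldr_cons, Matrix.transpose_mul, Matrix.transpose_transpose, ih]

end Chains

section Congr

variable {p' : Type} {c₀ : B13.Consts} {locp : p' → UT Nf} {locn : n → UT Nf} {K K' : (TPt d N' → ℂ) → E → Matrix p' n ℂ}
variable {X : Finset (UT Nf)} {R ε kap Kbar : ℝ}
variable {W : Type} {T : W → (TPt d N' → ℂ) → E → Matrix p' n ℂ} {SX : Set W} {A : W → ℝ}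
variable {D : W → UT Nf → UT Nf → ℝ} {ρ : ℝ}

omit [Fintype n] [DecidableEq n] in
/-- Transport along an equality of kernel families on polydisc × ball (the kernel enters only `hasSum`; private twin of
`B13JointWalkExpansionSymmetrize.jointWalkExpansion_congr_on`, kept local so that this file does not import the
conditioning chain). [cite: Balaban1985BackgroundPropagators, (3.107) p.416] -/
private theorem congr_on (h : JointWalkExpansion c₀ locp locn K X R ε kap Kbar T SX A D ρ)
    (hKK' : ∀ σ : TPt d N' → ℂ, (∀ j, ‖σ j‖ ≤ Real.exp c₀.κ₁) → ∀ u ∈ ball (0 : E) R, K σ u = K' σ u) :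
    JointWalkExpansion c₀ locp locn K' X R ε kap Kbar T SX A D ρ where
  hasSum σ hσ u hu i j := by rw [← hKK' σ hσ u hu]; exact h.hasSum σ hσ u hu i j
  termAnalytic := h.termAnalytic
  maj := h.maj
  majSum := h.majSum
  indep := h.indep
  through := h.through
  A_nonneg := h.A_nonneg
  D_nonneg := h.D_nonneg

end Congr

/-! ## §2. The identity family is its own one-term expansion -/

omit [Fintype n] in
/-- **THE IDENTITY IS A JOINT WALK EXPANSION** (one term, no σ, walk distance `d₁`): `‖1 a b‖ ≤ e^{−ρd₁(loc a, loc b)}`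
(the diagonal entries sit at distance `0`), partial sums `≤ 1·e^{−κd₁}` for `κ ≤ ρ − ε`; the seed of the resolvent
`(1 − K)⁻¹ = Σ Kⁿ·1`. [cite: Balaban1985BackgroundPropagators, (3.106) p.414] -/
theorem jointWalkExpansion_one (c₀ : B13.Consts) (locn : n → UT Nf) (X : Finset (UT Nf)) {R ρ ε κ : ℝ}
    (hκ : κ ≤ ρ - ε) :
    JointWalkExpansion c₀ locn locn (fun (_ : TPt d N' → ℂ) (_ : E) => (1 : Matrix n n ℂ)) X R ε κ 1
      (fun (_ : Unit) (_ : TPt d N' → ℂ) (_ : E) => (1 : Matrix n n ℂ)) (∅ : Set Unit) (fun _ => 1)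
      (fun _ a b => tdist1 Nf a b) ρ where
  hasSum σ _ u _ i j := by simp
  termAnalytic _ σ _ i j := differentiableOn_const _
  maj _ σ _ u _ i j := by
    by_cases h : i = j
    · subst h; simp [tdist1_self]
    · simp [Matrix.one_apply_ne h, (Real.exp_pos _).le]
  majSum S a b := by
    calc ∑ _ω ∈ S, (1 : ℝ) * Real.exp (-((ρ - ε) * tdist1 Nf a b))
        ≤ ∑ _ω ∈ (Finset.univ : Finset Unit), (1 : ℝ) * Real.exp (-((ρ - ε) * tdist1 Nf a b)) :=
          Finset.sum_le_sum_of_subset_of_nonneg (Finset.subset_univ S) fun _ _ _ => by positivity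
      _ = 1 * Real.exp (-((ρ - ε) * tdist1 Nf a b)) := by simp
      _ ≤ 1 * Real.exp (-(κ * tdist1 Nf a b)) :=
          mul_le_mul_of_nonneg_left (Real.exp_le_exp.2 (neg_le_neg
            (mul_le_mul_of_nonneg_right hκ (tdist1_nonneg a b)))) zero_le_one
  indep _ _ σ _ := rfl
  through ω hω := by simp at hω
  A_nonneg _ := zero_le_one
  D_nonneg _ a b := tdist1_nonneg a b

/-! ## §3. The resolvent applied to a walk-expanded seed: `(1 − K)⁻¹·C = Σₙ Kⁿ·C` -/

section Neumann

variable {c₀ : B13.Consts} {locn : n → UT Nf} {locq : q → UT Nf} {X : Finset (UT Nf)} {R : ℝ}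
variable {WK WC : Type}
variable {TK : WK → (TPt d N' → ℂ) → E → Matrix n n ℂ} {Km : (TPt d N' → ℂ) → E → Matrix n n ℂ}
variable {SXK : Set WK} {AK : WK → ℝ} {DK : WK → UT Nf → UT Nf → ℝ}
variable {TC : WC → (TPt d N' → ℂ) → E → Matrix n q ℂ} {Cm : (TPt d N' → ℂ) → E → Matrix n q ℂ}
variable {SXC : Set WC} {AC : WC → ℝ} {DC : WC → UT Nf → UT Nf → ℝ}
variable {ρK εK κK KbarK ρC εC κC KbarC ρ ε κ σ₁ c₁ σ' c' : ℝ} {m : ℕ}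

omit [DecidableEq n] in
/-- The entrywise chain bound at a chain rate `r ≤ ρ_C` with `r + σ₁ ≤ ρ_K`, for `(σ,u)` in polydisc × ball (module 26a
`norm_chain_entry_le` at the step ∕ seed per-term bounds of the two expansions). [cite: Balaban1985BackgroundPropagators, (3.108) p.416, (3.92)–(3.94) p.410] -/
private theorem chain_bound
    (hK : JointWalkExpansion c₀ locn locn Km X R εK κK KbarK TK SXK AK DK ρK)
    (hC : JointWalkExpansion c₀ locn locq Cm X R εC κC KbarC TC SXC AC DC ρC)
    (hKdom : ∀ i, DomBy (toB6 (torusGeom Nf 0 0 0) 0 True) (DK i))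
    (hCdom : ∀ ω, DomBy (toB6 (torusGeom Nf 0 0 0) 0 True) (DC ω))
    (hfib : ∀ y : UT Nf, (Finset.univ.filter fun k => locn k = y).card ≤ m)
    (hrow : RowSum (toB6 (torusGeom Nf 0 0 0) 0 True) σ₁ c₁) (hσ₁ : 0 ≤ σ₁)
    {r : ℝ} (hr : 0 ≤ r) (hrK : r + σ₁ ≤ ρK) (hrC : r ≤ ρC)
    {σ₀ : TPt d N' → ℂ} (hσ₀ : ∀ j, ‖σ₀ j‖ ≤ Real.exp c₀.κ₁) {u : E} (hu : u ∈ ball (0 : E) R)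
    (p : List WK × WC) (a : n) (b : q) :
    ‖(p.1.foldr (fun i M => TK i σ₀ u * M) (TC p.2 σ₀ u)) a b‖ ≤
      chainConst (m : ℝ) c₁ AK (AC p.2) p.1 *
        Real.exp (-(r * chainDist (g := toB6 (torusGeom Nf 0 0 0) 0 True) DK (DC p.2) p.1 (locn a) (locq b))) :=
  norm_chain_entry_le (Nf := Nf) locn locq hfib hK.A_nonneg (hC.A_nonneg p.2) hr hσ₁ hrK hKdom (hCdom p.2) hrow
    (fun i a k => hK.maj i σ₀ hσ₀ u hu a k)
    (fun a k => (hC.maj p.2 σ₀ hσ₀ u hu a k).trans (mul_le_mul_of_nonneg_left (Real.exp_le_exp.2 (neg_le_neg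
      (mul_le_mul_of_nonneg_right hrC ((hdnn_torusGeom 0 0 0 _ _).trans (hCdom p.2 _ _))))) (hC.A_nonneg p.2)))
    p.1 a b

omit [Fintype n] [DecidableEq n] in
/-- The uniform partial sums of the chain majorants at any chain rate `r` inside both drop windows (module 26a
`majSumLe_chain`, i.e. `B9SectDWalk.neumann_majSumLe`): constant `K̄_C(1 − q)⁻¹`, torus rate `κ`.
[cite: Balaban1985BackgroundPropagators, p.422 (after (3.131)), Thm 3.12 p.423; Balaban1984PropagatorsII, Lemma 2.1 p.234] -/
private theorem chain_majSum
    (hK : JointWalkExpansion c₀ locn locn Km X R εK κK KbarK TK SXK AK DK ρK)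
    (hC : JointWalkExpansion c₀ locn locq Cm X R εC κC KbarC TC SXC AC DC ρC)
    (hKdom : ∀ i, DomBy (toB6 (torusGeom Nf 0 0 0) 0 True) (DK i))
    (hCdom : ∀ ω, DomBy (toB6 (torusGeom Nf 0 0 0) 0 True) (DC ω))
    (hrow' : RowSum (toB6 (torusGeom Nf 0 0 0) 0 True) σ' c') (hσ' : 0 ≤ σ') (hc₁ : 0 ≤ c₁)
    (hKK : 0 ≤ KbarK) (hKC : 0 ≤ KbarC) (hκ : 0 ≤ κ) (hκC : κ ≤ κC) (hκK : κ + σ' ≤ κK)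
    (hq : (m * c₁) * KbarK * c' < 1) {r : ℝ} (hrK : ρK - εK ≤ r) (hrC : ρC - εC ≤ r) :
    MajSumLe (g := toB6 (torusGeom Nf 0 0 0) 0 True)
      (fun (p : List WK × WC) a b => chainConst (m : ℝ) c₁ AK (AC p.2) p.1 *
        Real.exp (-(r * chainDist (g := toB6 (torusGeom Nf 0 0 0) 0 True) DK (DC p.2) p.1 a b)))
      (fun a b => KbarC * (1 - (m * c₁) * KbarK * c')⁻¹ * Real.exp (-(κ * tdist1 Nf a b))) :=
  majSumLe_chain (Nf := Nf) hK.A_nonneg hC.A_nonneg hc₁ hrK hrC hKdom hCdom hrow' hσ' hKK hKC hκ hκC hκK hK.majSum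
    hC.majSum hq

/-- **THE RESOLVENT IDENTITIES FROM THE WALK DATA** (for `(σ,u)` in polydisc × ball): the (chain, seed) family is
summable entrywise, `1 − K(σ,u)` is invertible, and its sum is `(1 − K)⁻¹·C` — module 26a's `hasSum_levels` +
`one_sub_mul_tsum_eq` run twice, once with the given seed and once with the identity seed (whose sum inverts `1 − K`).
[cite: Balaban1985BackgroundPropagators, (3.106) p.414, (3.130) p.421, p.422] -/
private theorem resolvent_identities
    (hK : JointWalkExpansion c₀ locn locn Km X R εK κK KbarK TK SXK AK DK ρK)
    (hC : JointWalkExpansion c₀ locn locq Cm X R εC κC KbarC TC SXC AC DC ρC)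
    (hKdom : ∀ i, DomBy (toB6 (torusGeom Nf 0 0 0) 0 True) (DK i))
    (hCdom : ∀ ω, DomBy (toB6 (torusGeom Nf 0 0 0) 0 True) (DC ω))
    (hfib : ∀ y : UT Nf, (Finset.univ.filter fun k => locn k = y).card ≤ m)
    (hrow : RowSum (toB6 (torusGeom Nf 0 0 0) 0 True) σ₁ c₁) (hrow' : RowSum (toB6 (torusGeom Nf 0 0 0) 0 True) σ' c')
    (hσ₁ : 0 ≤ σ₁) (hσ' : 0 ≤ σ') (hc₁ : 0 ≤ c₁)
    (hεK : 0 ≤ εK) (hρ : 0 ≤ ρ) (hρK : ρ + σ₁ ≤ ρK) (hρC : ρ ≤ ρC) (hwK : ρK - εK ≤ ρ) (hwC : ρC - εC ≤ ρ)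
    (hKK : 0 ≤ KbarK) (hKC : 0 ≤ KbarC) (hκ : 0 ≤ κ) (hκC : κ ≤ κC) (hκK : κ + σ' ≤ κK)
    (hq : (m * c₁) * KbarK * c' < 1)
    {σ₀ : TPt d N' → ℂ} (hσ₀ : ∀ j, ‖σ₀ j‖ ≤ Real.exp c₀.κ₁) {u : E} (hu : u ∈ ball (0 : E) R) :
    (∀ a b, Summable fun p : List WK × WC => (p.1.foldr (fun i M => TK i σ₀ u * M) (TC p.2 σ₀ u)) a b) ∧
    (1 - Km σ₀ u) * (1 - Km σ₀ u)⁻¹ = 1 ∧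
    (Matrix.of fun a b => ∑' p : List WK × WC, (p.1.foldr (fun i M => TK i σ₀ u * M) (TC p.2 σ₀ u)) a b) =
      (1 - Km σ₀ u)⁻¹ * Cm σ₀ u := by
  classical
  -- the step data at (σ₀,u): entrywise sums, per-term bounds at rate ρ_K, partial sums
  have hS : ∀ a k, HasSum (fun i => TK i σ₀ u a k) (Km σ₀ u a k) := fun a k => hK.hasSum σ₀ hσ₀ u hu a k
  have hSmaj : ∀ i a k, ‖TK i σ₀ u a k‖ ≤ AK i * Real.exp (-(ρK * DK i (locn a) (locn k))) :=
    fun i a k => hK.maj i σ₀ hσ₀ u hu a k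
  have hSB : ∀ (F : Finset WK) a k, ∑ i ∈ F, AK i * Real.exp (-(ρK * DK i (locn a) (locn k))) ≤
      KbarK * Real.exp (-(κK * tdist1 Nf (locn a) (locn k))) := fun F a k => hK.majSum_full hεK F (locn a) (locn k)
  -- (i) the given seed: (1 − K)·X_C = C
  have hT : ∀ k b, HasSum (fun ω => TC ω σ₀ u k b) (Cm σ₀ u k b) := fun k b => hC.hasSum σ₀ hσ₀ u hu k b
  have hM := chain_bound hK hC hKdom hCdom hfib hrow hσ₁ hρ hρK hρC hσ₀ hu
  have hB : ∀ (F : Finset (List WK × WC)) k b, ∑ p ∈ F, chainConst (m : ℝ) c₁ AK (AC p.2) p.1 *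
      Real.exp (-(ρ * chainDist (g := toB6 (torusGeom Nf 0 0 0) 0 True) DK (DC p.2) p.1 (locn k) (locq b))) ≤
      KbarC * (1 - (m * c₁) * KbarK * c')⁻¹ * Real.exp (-(κ * tdist1 Nf (locn k) (locq b))) :=
    fun F k b => chain_majSum hK hC hKdom hCdom hrow' hσ' hc₁ hKK hKC hκ hκC hκK hq hwK hwC F (locn k) (locq b)
  have hsumC := fun a b => (hasSum_levels hS hSmaj hSB hT hM hB a b).1
  have hidC := one_sub_mul_tsum_eq hS hSmaj hSB hT hM hB
  -- (ii) the identity seed: (1 − K)·X₁ = 1, hence `1 − K` is invertible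
  have h1 := jointWalkExpansion_one (d := d) (N' := N') (E := E) c₀ locn X (R := R)
    (show (0 : ℝ) ≤ ρ - 0 by linarith)
  have hT₁ : ∀ k b, HasSum (fun _ : Unit => (1 : Matrix n n ℂ) k b) ((1 : Matrix n n ℂ) k b) :=
    fun k b => h1.hasSum σ₀ hσ₀ u hu k b
  have hM₁ := chain_bound hK h1 hKdom (fun _ y y' => le_rfl) hfib hrow hσ₁ hρ hρK le_rfl hσ₀ hu
  have hB₁ : ∀ (F : Finset (List WK × Unit)) k b, ∑ p ∈ F, chainConst (m : ℝ) c₁ AK ((fun _ : Unit => (1 : ℝ)) p.2) p.1 *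
      Real.exp (-(ρ * chainDist (g := toB6 (torusGeom Nf 0 0 0) 0 True) DK ((fun _ : Unit => fun a b => tdist1 Nf a b) p.2) p.1
        (locn k) (locn b))) ≤
      1 * (1 - (m * c₁) * KbarK * c')⁻¹ * Real.exp (-(0 * tdist1 Nf (locn k) (locn b))) :=
    fun F k b => chain_majSum (κ := 0) hK h1 hKdom (fun _ y y' => le_rfl) hrow' hσ' hc₁ hKK zero_le_one le_rfl le_rfl
      (by linarith) hq hwK (by linarith) F (locn k) (locn b)
  have hid₁ := one_sub_mul_tsum_eq hS hSmaj hSB hT₁ hM₁ hB₁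
  have hinv : (1 - Km σ₀ u)⁻¹ =
      Matrix.of fun a b => ∑' p : List WK × Unit, (p.1.foldr (fun i M => TK i σ₀ u * M) (1 : Matrix n n ℂ)) a b :=
    Matrix.inv_eq_right_inv hid₁
  refine ⟨hsumC, by rw [hinv, hid₁], ?_⟩
  -- X_C = (1 − K)⁻¹·((1 − K)·X_C) = (1 − K)⁻¹·C
  have hunit : IsUnit (1 - Km σ₀ u).det := Matrix.isUnit_det_of_right_inverse hid₁
  rw [← hidC, ← Matrix.mul_assoc, Matrix.nonsing_inv_mul _ hunit, Matrix.one_mul]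

/-- **THE RESOLVENT OF A WALK-EXPANDED SMALL FAMILY APPLIED TO A WALK-EXPANDED SEED IS A JOINT WALK EXPANSION**
([13] (3.106) ∕ (3.130) ∕ p. 422 at the FULL shape; Literature home, in the general «step ∕ seed» form, of the
Summit-side `Gaps.D4WalkNeumann.jointWalkExpansion_inv`).  DATA: joint walk expansions of the STEP family `K(σ,u)`
(square, rows ∕ columns located by `locn`; per-term rate `ρ_K`, window `ε_K ≥ 0`, torus rate `κ_K`, constant `K̄_K ≥ 0`,
σ-carrying sub-family `SX_K`) and of the SEED family `C(σ,u)` (rows `locn`, columns `locq`; `ρ_C, ε_C ≥ 0, κ_C,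
K̄_C ≥ 0, SX_C`), the same σ-region `X` and ball, all walk distances dominating `d₁`, fibre multiplicity `m` of `locn`,
row sums (2.61) at the junction rate `σ₁ ≥ 0` (constant `c₁ ≥ 0`) and at `σ′ ≥ 0` (constant `c′`).  RATES: chain rate
`ρ` and window `0 ≤ ε ≤ ρ` with `ρ + σ₁ ≤ ρ_K` (EVERY step pays its own junction row sum from its excess rate — ONE
rate for all chain lengths), `ρ ≤ ρ_C`, BOTH factor windows containing the chain window (`ρ_K − ε_K ≤ ρ − ε`,
`ρ_C − ε_C ≤ ρ − ε`); torus rate `0 ≤ κ ≤ κ_C`, `κ + σ′ ≤ κ_K`; the MARGIN SMALLNESS `q = (mc₁)·K̄_K·c′ < 1`.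
CONCLUSION: `(σ,u) ↦ (1 − K(σ,u))⁻¹·C(σ,u)` is a `JointWalkExpansion` with the Neumann chains as terms, σ-carrying
sub-family «seed or some step carries σ», amplitudes `chainConst m c₁ A_K (A_C ω) l`, distances
`chainDist D_K (D_C ω) l`, rate `ρ`, window `ε`, torus rate `κ`, constant `K̄_C(1 − q)⁻¹`.  `hasSum` = module 26a's
level sums + resolvent identity (invertibility of `1 − K` from the identity seed); `maj` = `norm_chain_entry_le` at
rate `ρ`; `majSum` = `majSumLe_chain` at rate `ρ − ε`; `termAnalytic ∕ indep ∕ through ∕ D_nonneg` = §1 + the chain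
geometry of `B9SectDWalk`. [cite: Balaban1985BackgroundPropagators, (3.106) p.414, (3.130) p.421, p.422, Thm 3.12 p.423, (3.107)–(3.108) p.416, (3.93) p.410; Balaban1988RG2Cluster, (1.11) p.5, p.13, p.15; Balaban1984PropagatorsII, (2.54) p.233, Lemma 2.1 (2.61) p.234] -/
theorem jointWalkExpansion_neumann
    (hK : JointWalkExpansion c₀ locn locn Km X R εK κK KbarK TK SXK AK DK ρK)
    (hC : JointWalkExpansion c₀ locn locq Cm X R εC κC KbarC TC SXC AC DC ρC)
    (hKdom : ∀ i, DomBy (toB6 (torusGeom Nf 0 0 0) 0 True) (DK i))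
    (hCdom : ∀ ω, DomBy (toB6 (torusGeom Nf 0 0 0) 0 True) (DC ω))
    (hfib : ∀ y : UT Nf, (Finset.univ.filter fun k => locn k = y).card ≤ m)
    (hrow : RowSum (toB6 (torusGeom Nf 0 0 0) 0 True) σ₁ c₁) (hrow' : RowSum (toB6 (torusGeom Nf 0 0 0) 0 True) σ' c')
    (hσ₁ : 0 ≤ σ₁) (hσ' : 0 ≤ σ') (hc₁ : 0 ≤ c₁)
    (hεK : 0 ≤ εK) (hε : 0 ≤ ε) (hερ : ε ≤ ρ) (hρK : ρ + σ₁ ≤ ρK) (hρC : ρ ≤ ρC)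
    (hwK : ρK - εK ≤ ρ - ε) (hwC : ρC - εC ≤ ρ - ε)
    (hKK : 0 ≤ KbarK) (hKC : 0 ≤ KbarC) (hκ : 0 ≤ κ) (hκC : κ ≤ κC) (hκK : κ + σ' ≤ κK)
    (hq : (m * c₁) * KbarK * c' < 1) :
    JointWalkExpansion c₀ locn locq (fun σ₀ u => (1 - Km σ₀ u)⁻¹ * Cm σ₀ u) X R ε κ
      (KbarC * (1 - (m * c₁) * KbarK * c')⁻¹)
      (fun (p : List WK × WC) σ₀ u => p.1.foldr (fun i M => TK i σ₀ u * M) (TC p.2 σ₀ u))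
      {p | p.2 ∈ SXC ∨ ∃ i ∈ p.1, i ∈ SXK}
      (fun p => chainConst (m : ℝ) c₁ AK (AC p.2) p.1)
      (fun p => chainDist (g := toB6 (torusGeom Nf 0 0 0) 0 True) DK (DC p.2) p.1) ρ := by
  have hρ : 0 ≤ ρ := hε.trans hερ
  have hwK' : ρK - εK ≤ ρ := hwK.trans (sub_le_self ρ hε)
  have hwC' : ρC - εC ≤ ρ := hwC.trans (sub_le_self ρ hε)
  exact
  { hasSum := fun σ₀ hσ₀ u hu i j => by
      obtain ⟨hsum, -, hX⟩ := resolvent_identities hK hC hKdom hCdom hfib hrow hrow' hσ₁ hσ' hc₁ hεK hρ hρK hρC hwK'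
        hwC' hKK hKC hκ hκC hκK hq hσ₀ hu
      have e : ((1 - Km σ₀ u)⁻¹ * Cm σ₀ u) i j =
          ∑' p : List WK × WC, (p.1.foldr (fun i M => TK i σ₀ u * M) (TC p.2 σ₀ u)) i j := by
        rw [← hX, Matrix.of_apply]
      rw [e]
      exact (hsum i j).hasSum
    termAnalytic := fun p σ₀ hσ₀ a b =>
      differentiableOn_chain (S := fun i u => TK i σ₀ u) (T₀ := fun u => TC p.2 σ₀ u)
        (fun i a k => hK.termAnalytic i σ₀ hσ₀ a k) (fun k b => hC.termAnalytic p.2 σ₀ hσ₀ k b) p.1 a b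
    maj := fun p σ₀ hσ₀ u hu a b => chain_bound hK hC hKdom hCdom hfib hrow hσ₁ hρ hρK hρC hσ₀ hu p a b
    majSum := chain_majSum hK hC hKdom hCdom hrow' hσ' hc₁ hKK hKC hκ hκC hκK hq hwK hwC
    indep := fun p hp σ₀ hσ₀ => by
      simp only [Set.mem_setOf_eq, not_or, not_exists, not_and] at hp
      exact chain_congr p.1 (fun i hi => hK.indep i (hp.2 i hi) σ₀ hσ₀) (hC.indep p.2 hp.1 σ₀ hσ₀)
    through := fun p hp => by
      rcases hp with hseed | ⟨i, hi, hstep⟩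
      · exact through_chainDist_seed (htri_torusGeom 0 0 0 0 True) hKdom (hC.through p.2 hseed) p.1
      · exact through_chainDist_mem (htri_torusGeom 0 0 0 0 True) hKdom (hCdom p.2) (hK.through i hstep) p.1 hi
    A_nonneg := fun p => B9SectDWalk.chainConst_nonneg (Nat.cast_nonneg m) hc₁ hK.A_nonneg (hC.A_nonneg p.2) p.1
    D_nonneg := fun p a b => chainDist_nonneg hKdom (hCdom p.2) p.1 a b }

/-- **INVERTIBILITY OF `1 − K` FROM THE WALK DATA ALONE** (no seed): under the step-family hypotheses of
`jointWalkExpansion_neumann`, `(1 − K(σ,u))·(1 − K(σ,u))⁻¹ = 1` on polydisc × ball — [13] p. 414 *"R satisfies the bound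
(3.85) with O(M⁻¹) … For M sufficiently large this implies G = G₀(I − R)⁻¹"*. [cite: Balaban1985BackgroundPropagators, (3.106) p.414, p.422] -/
theorem one_sub_mul_inv_of_jointWalkExpansion
    (hK : JointWalkExpansion c₀ locn locn Km X R εK κK KbarK TK SXK AK DK ρK)
    (hKdom : ∀ i, DomBy (toB6 (torusGeom Nf 0 0 0) 0 True) (DK i))
    (hfib : ∀ y : UT Nf, (Finset.univ.filter fun k => locn k = y).card ≤ m)
    (hrow : RowSum (toB6 (torusGeom Nf 0 0 0) 0 True) σ₁ c₁) (hrow' : RowSum (toB6 (torusGeom Nf 0 0 0) 0 True) σ' c')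
    (hσ₁ : 0 ≤ σ₁) (hσ' : 0 ≤ σ') (hc₁ : 0 ≤ c₁)
    (hεK : 0 ≤ εK) (hρ : 0 ≤ ρ) (hρK : ρ + σ₁ ≤ ρK) (hwK : ρK - εK ≤ ρ)
    (hKK : 0 ≤ KbarK) (hκK : σ' ≤ κK) (hq : (m * c₁) * KbarK * c' < 1)
    {σ₀ : TPt d N' → ℂ} (hσ₀ : ∀ j, ‖σ₀ j‖ ≤ Real.exp c₀.κ₁) {u : E} (hu : u ∈ ball (0 : E) R) :
    (1 - Km σ₀ u) * (1 - Km σ₀ u)⁻¹ = 1 := by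
  have h1 := jointWalkExpansion_one (d := d) (N' := N') (E := E) c₀ locn X (R := R)
    (show (0 : ℝ) ≤ ρ - 0 by linarith)
  exact (resolvent_identities (κ := 0) hK h1 hKdom (fun _ y y' => le_rfl) hfib hrow hrow' hσ₁ hσ' hc₁ hεK hρ hρK le_rfl
    hwK (by linarith) hKK zero_le_one le_rfl le_rfl (by linarith) hq hσ₀ hu).2.1

/-- **Domination for the Neumann family's walk distances** (so the resolvent can be multiplied ∕ inverted again).
[cite: Balaban1984PropagatorsII, (2.54) p.233; Balaban1985BackgroundPropagators, (3.93) p.410] -/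
theorem domBy_chain (hKdom : ∀ i, DomBy (toB6 (torusGeom Nf 0 0 0) 0 True) (DK i))
    (hCdom : ∀ ω, DomBy (toB6 (torusGeom Nf 0 0 0) 0 True) (DC ω)) (p : List WK × WC) :
    DomBy (toB6 (torusGeom Nf 0 0 0) 0 True) (chainDist (g := toB6 (torusGeom Nf 0 0 0) 0 True) DK (DC p.2) p.1) :=
  domBy_chainDist (htri_torusGeom 0 0 0 0 True) hKdom (hCdom p.2) p.1

end Neumann

/-! ## §4. The resolvent alone, and the seed on the left: `(1 − K)⁻¹ = Σ Kⁿ`, `C·(1 − K)⁻¹ = Σ C·Kⁿ` ((3.106)) -/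

section Resolvent

variable {c₀ : B13.Consts} {locn : n → UT Nf} {locq : q → UT Nf} {X : Finset (UT Nf)} {R : ℝ}
variable {WK WC : Type}
variable {TK : WK → (TPt d N' → ℂ) → E → Matrix n n ℂ} {Km : (TPt d N' → ℂ) → E → Matrix n n ℂ}
variable {SXK : Set WK} {AK : WK → ℝ} {DK : WK → UT Nf → UT Nf → ℝ}
variable {TC : WC → (TPt d N' → ℂ) → E → Matrix q n ℂ} {Cm : (TPt d N' → ℂ) → E → Matrix q n ℂ}
variable {SXC : Set WC} {AC : WC → ℝ} {DC : WC → UT Nf → UT Nf → ℝ}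
variable {ρK εK κK KbarK ρC εC κC KbarC ρ ε κ σ₁ c₁ σ' c' : ℝ} {m : ℕ}

/-- **THE RESOLVENT `(1 − K)⁻¹ = Σₙ Kⁿ` OF A WALK-EXPANDED SMALL FAMILY IS A JOINT WALK EXPANSION** (the identity seed of
§2 in `jointWalkExpansion_neumann`): terms the chains `T_K(i₁)⋯T_K(iₙ)` on `List W_K × Unit`, σ-carrying sub-family
«some step carries σ», amplitudes `chainConst m c₁ A_K 1 l`, distances `chainDist D_K d₁ l`, rate `ρ`, window `ε`
(`0 ≤ ε ≤ ρ`, `ρ + σ₁ ≤ ρ_K`, `ρ_K − ε_K ≤ ρ − ε`), torus rate `0 ≤ κ ≤ ρ − ε`, `κ + σ′ ≤ κ_K`, smallness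
`q = (mc₁)·K̄_K·c′ < 1`, constant `(1 − q)⁻¹`. [cite: Balaban1985BackgroundPropagators, (3.106) p.414, (3.130) p.421, p.422; Balaban1988RG2Cluster, p.13] -/
theorem jointWalkExpansion_resolvent
    (hK : JointWalkExpansion c₀ locn locn Km X R εK κK KbarK TK SXK AK DK ρK)
    (hKdom : ∀ i, DomBy (toB6 (torusGeom Nf 0 0 0) 0 True) (DK i))
    (hfib : ∀ y : UT Nf, (Finset.univ.filter fun k => locn k = y).card ≤ m)
    (hrow : RowSum (toB6 (torusGeom Nf 0 0 0) 0 True) σ₁ c₁) (hrow' : RowSum (toB6 (torusGeom Nf 0 0 0) 0 True) σ' c')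
    (hσ₁ : 0 ≤ σ₁) (hσ' : 0 ≤ σ') (hc₁ : 0 ≤ c₁)
    (hεK : 0 ≤ εK) (hε : 0 ≤ ε) (hερ : ε ≤ ρ) (hρK : ρ + σ₁ ≤ ρK) (hwK : ρK - εK ≤ ρ - ε)
    (hKK : 0 ≤ KbarK) (hκ : 0 ≤ κ) (hκρ : κ ≤ ρ - ε) (hκK : κ + σ' ≤ κK)
    (hq : (m * c₁) * KbarK * c' < 1) :
    JointWalkExpansion c₀ locn locn (fun σ₀ u => (1 - Km σ₀ u)⁻¹) X R ε κ (1 * (1 - (m * c₁) * KbarK * c')⁻¹)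
      (fun (p : List WK × Unit) σ₀ u => p.1.foldr (fun i M => TK i σ₀ u * M) 1)
      {p | p.2 ∈ (∅ : Set Unit) ∨ ∃ i ∈ p.1, i ∈ SXK}
      (fun p => chainConst (m : ℝ) c₁ AK 1 p.1)
      (fun p => chainDist (g := toB6 (torusGeom Nf 0 0 0) 0 True) DK (fun a b => tdist1 Nf a b) p.1) ρ := by
  have h1 := jointWalkExpansion_one (d := d) (N' := N') (E := E) c₀ locn X (R := R) hκρ
  have h := jointWalkExpansion_neumann hK h1 hKdom (fun _ y y' => le_rfl) hfib hrow hrow' hσ₁ hσ' hc₁ hεK hε hερ hρK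
    le_rfl hwK le_rfl hKK zero_le_one hκ le_rfl hκK hq
  -- `(1 − K)⁻¹·1 = (1 − K)⁻¹`
  exact congr_on h fun σ₀ _ u _ => Matrix.mul_one _

/-- **THE SEED ON THE LEFT — (3.106) LITERALLY: `C·(1 − K)⁻¹ = Σₙ C·Kⁿ` IS A JOINT WALK EXPANSION.**  Same data as
`jointWalkExpansion_neumann` for a seed family with columns located by `locn` (rows by `locq`); the terms are
`T_C(ω)·T_K(iₙ)⋯T_K(i₁)` (the seed followed by the steps, the list read from the end), the walk distances are the
left-form chain distances of the transposed data read backwards, `D′_{(l,ω)}(a,b) = chainDist D_Kᵀ D_{C,ω}ᵀ l (b,a)` —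
obtained from §3 by two transpositions (`B13JointWalkExpansionAlgebra.jointWalkExpansion_transpose`, `transpose_chain`,
`((1 − Kᵀ)⁻¹Cᵀ)ᵀ = C(1 − K)⁻¹`).  This is the form in which [13]'s `G = G₀(I − R)⁻¹` (parametrix `G₀ = Σ_□ h_□G_□h_□` as
seed, remainder `R` of (3.105) as step family) is a joint walk expansion with walks `((0,X₀),(α₁,X₁),…,(αₙ,Xₙ))`.
[cite: Balaban1985BackgroundPropagators, (3.105)–(3.106) p.414, (3.107)–(3.108) p.416, (3.130) p.421, p.422; Balaban1988RG2Cluster, p.13] -/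
theorem jointWalkExpansion_neumann_right
    (hK : JointWalkExpansion c₀ locn locn Km X R εK κK KbarK TK SXK AK DK ρK)
    (hC : JointWalkExpansion c₀ locq locn Cm X R εC κC KbarC TC SXC AC DC ρC)
    (hKdom : ∀ i, DomBy (toB6 (torusGeom Nf 0 0 0) 0 True) (DK i))
    (hCdom : ∀ ω, DomBy (toB6 (torusGeom Nf 0 0 0) 0 True) (DC ω))
    (hfib : ∀ y : UT Nf, (Finset.univ.filter fun k => locn k = y).card ≤ m)
    (hrow : RowSum (toB6 (torusGeom Nf 0 0 0) 0 True) σ₁ c₁) (hrow' : RowSum (toB6 (torusGeom Nf 0 0 0) 0 True) σ' c')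
    (hσ₁ : 0 ≤ σ₁) (hσ' : 0 ≤ σ') (hc₁ : 0 ≤ c₁)
    (hεK : 0 ≤ εK) (hε : 0 ≤ ε) (hερ : ε ≤ ρ) (hρK : ρ + σ₁ ≤ ρK) (hρC : ρ ≤ ρC)
    (hwK : ρK - εK ≤ ρ - ε) (hwC : ρC - εC ≤ ρ - ε)
    (hKK : 0 ≤ KbarK) (hKC : 0 ≤ KbarC) (hκ : 0 ≤ κ) (hκC : κ ≤ κC) (hκK : κ + σ' ≤ κK)
    (hq : (m * c₁) * KbarK * c' < 1) :
    JointWalkExpansion c₀ locq locn (fun σ₀ u => Cm σ₀ u * (1 - Km σ₀ u)⁻¹) X R ε κ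
      (KbarC * (1 - (m * c₁) * KbarK * c')⁻¹)
      (fun (p : List WK × WC) σ₀ u => p.1.foldr (fun i M => M * TK i σ₀ u) (TC p.2 σ₀ u))
      {p | p.2 ∈ SXC ∨ ∃ i ∈ p.1, i ∈ SXK}
      (fun p => chainConst (m : ℝ) c₁ AK (AC p.2) p.1)
      (fun p a b => chainDist (g := toB6 (torusGeom Nf 0 0 0) 0 True) (fun i a b => DK i b a) (fun a b => DC p.2 b a) p.1 b a)
      ρ := by
  -- transpose both factors, run §3, transpose back
  have hKt := jointWalkExpansion_transpose hK
  have hCt := jointWalkExpansion_transpose hC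
  have hKdomt : ∀ i, DomBy (toB6 (torusGeom Nf 0 0 0) 0 True) (fun a b => DK i b a) := fun i y y' => by
    have h := hKdom i y' y
    have e1 : (toB6 (torusGeom Nf 0 0 0) 0 True).dist y y' = tdist1 Nf y y' := rfl
    have e2 : (toB6 (torusGeom Nf 0 0 0) 0 True).dist y' y = tdist1 Nf y' y := rfl
    rw [e2] at h; rw [e1, tdist1_comm y y']; exact h
  have hCdomt : ∀ ω, DomBy (toB6 (torusGeom Nf 0 0 0) 0 True) (fun a b => DC ω b a) := fun ω y y' => by
    have h := hCdom ω y' y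
    have e1 : (toB6 (torusGeom Nf 0 0 0) 0 True).dist y y' = tdist1 Nf y y' := rfl
    have e2 : (toB6 (torusGeom Nf 0 0 0) 0 True).dist y' y = tdist1 Nf y' y := rfl
    rw [e2] at h; rw [e1, tdist1_comm y y']; exact h
  have h := jointWalkExpansion_neumann (Km := fun σ₀ u => (Km σ₀ u)ᵀ) (Cm := fun σ₀ u => (Cm σ₀ u)ᵀ)
    (TK := fun i σ₀ u => (TK i σ₀ u)ᵀ) (TC := fun ω σ₀ u => (TC ω σ₀ u)ᵀ) hKt hCt hKdomt hCdomt hfib hrow hrow' hσ₁ hσ'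
    hc₁ hεK hε hερ hρK hρC hwK hwC hKK hKC hκ hκC hκK hq
  have ht := jointWalkExpansion_transpose h
  -- identify the kernel `((1 − Kᵀ)⁻¹·Cᵀ)ᵀ = C·(1 − K)⁻¹` and the terms `(chain of transposes)ᵀ = seed · steps`
  have hker : ∀ σ₀ u, ((1 - (Km σ₀ u)ᵀ)⁻¹ * (Cm σ₀ u)ᵀ)ᵀ = Cm σ₀ u * (1 - Km σ₀ u)⁻¹ := by
    intro σ₀ u
    rw [Matrix.transpose_mul, Matrix.transpose_transpose, Matrix.transpose_nonsing_inv, Matrix.transpose_sub,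
      Matrix.transpose_one, Matrix.transpose_transpose]
  refine (congr_on ht fun σ₀ _ u _ => hker σ₀ u) |> fun h' => ?_
  convert h' using 1
  · funext p σ₀ u
    exact (transpose_chain (S := fun i => TK i σ₀ u) (T₀ := TC p.2 σ₀ u) p.1).symm
  · rfl

/-- **Domination for the right form's walk distances.** [cite: Balaban1984PropagatorsII, (2.54) p.233; Balaban1985BackgroundPropagators, (3.93) p.410] -/
theorem domBy_chain_right (hKdom : ∀ i, DomBy (toB6 (torusGeom Nf 0 0 0) 0 True) (DK i))
    (hCdom : ∀ ω, DomBy (toB6 (torusGeom Nf 0 0 0) 0 True) (DC ω)) (p : List WK × WC) :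
    DomBy (toB6 (torusGeom Nf 0 0 0) 0 True)
      (fun a b => chainDist (g := toB6 (torusGeom Nf 0 0 0) 0 True) (fun i a b => DK i b a) (fun a b => DC p.2 b a) p.1 b a) := by
  have flip : ∀ {D : UT Nf → UT Nf → ℝ}, DomBy (toB6 (torusGeom Nf 0 0 0) 0 True) D →
      DomBy (toB6 (torusGeom Nf 0 0 0) 0 True) (fun a b => D b a) := fun {D} hD y y' => by
    have h := hD y' y
    have e1 : (toB6 (torusGeom Nf 0 0 0) 0 True).dist y y' = tdist1 Nf y y' := rfl
    have e2 : (toB6 (torusGeom Nf 0 0 0) 0 True).dist y' y = tdist1 Nf y' y := rfl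
    rw [e2] at h; rw [e1, tdist1_comm y y']; exact h
  exact flip (domBy_chainDist (htri_torusGeom 0 0 0 0 True) (fun i => flip (hKdom i)) (flip (hCdom p.2)) p.1)

end Resolvent

end Literature.MathematicalPhysics.QuantumFieldTheory.Balaban1983to89.B13JointWalkExpansionNeumann

end
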